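import Literature.NumberTheory.EllipticCurves.PadicSeriesEvaluation
import Summits.BirchSwinnertonDyer.BirchSwinnertonDyer.Theorems.TangentConeEdgeDecayStubNormCycPow
import Summits.BirchSwinnertonDyer.BirchSwinnertonDyer.Theorems.TangentConeEdgeCapStubNormOneAddPowSubOne

/-!
# `TangentCone.EdgeCap` (stmt-BirchSwinnertonDyer-17609), line `Sketch`: stub `stub_deepArcGlue`

A deep pointwise cap determines the arc order (pure `p`-adic analysis over `ℚ_p`).

For an odd prime `p`, an integral `F ∈ ℚ_p⟦X₀, X₁⟧`, exponents `a, b`, a rate `s` and a constant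
`C`: if for every depth `m` there is a parameter `t > 0` with `v_p(t) ≥ m` and
`‖F((1+p)^(bt) − 1, (1+p)^(at) − 1)‖ · p^(s (v_p(t)+1)) ≤ p^C`, then
`‖F((1+p)^(bt) − 1, (1+p)^(at) − 1)‖ ≤ ‖t‖_p^s` for EVERY `t > 0`.

Proof. Put `T_t = (1+p)^t − 1`, so `‖T_t‖ = p^(−v_p(t)−1)` (lifting the exponent, tree theorem
`stub_normCycPow`) and `‖T_t‖ ≤ ‖p‖ ‖t‖ ≤ ‖t‖` (`stub_normOneAddPowSubOne`). The arc values are the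
values `h(T_t)` of ONE integral one-variable series `h`: substitute the pair
`((1 + X₀)^b − 1, (1 + X₀)^a − 1)` into `F` (`padicEval₂_substPair`) and restrict the resulting
two-variable series `H` to the axis `X₁ = 0`, `h = Σ_n H_(n,0) Xⁿ` (`padicEval₂ H u 0 = padicEval h u`,
a re-indexing of the defining `tsum`). On `h` the order argument: if the coefficients below degree
`e` vanish then `‖h(u)‖ ≤ ‖u‖^e` and `‖h(u) − h_e u^e‖ ≤ ‖u‖^(e+1)` (ultrametric `tsum` bound), so at
a deep point `u` with `‖u‖ < ‖h_e‖` the leading term dominates, `‖h(u)‖ = ‖h_e‖ ‖u‖^e`, and the cap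
`‖h(u)‖ ≤ p^C ‖u‖^s` with `e < s` forces `‖h_e‖ ≤ p^C ‖u‖ → 0`; hence `h_0 = … = h_(s−1) = 0` and
`‖h(u)‖ ≤ ‖u‖^s` on the open unit disc. No new definitions; helpers are `private`.
-/

set_option linter.dupNamespace false

noncomputable section

namespace Summit.BirchSwinnertonDyer.BirchSwinnertonDyer.Theorems

open Literature.NumberTheory.EllipticCurves PowerSeries

variable {p : ℕ} [Fact p.Prime]

/-! ## One variable: order of vanishing at `0` decided by deep points -/

/-- If the coefficients of an integral `h ∈ ℚ_p⟦X⟧` below degree `e` vanish, then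
`‖h(u)‖ ≤ ‖u‖^e` for `‖u‖ < 1` (every term `h_n u^n`, `n ≥ e`, has norm `≤ ‖u‖^e`; ultrametric
`tsum` bound). [folklore] -/
private theorem deepArcGlue_norm_padicEval_le_pow {h : ℚ_[p]⟦X⟧} (hh : IsPadicInt h) {e : ℕ}
    (he : ∀ n, n < e → coeff n h = 0) {u : ℚ_[p]} (hu : ‖u‖ < 1) :
    ‖padicEval h u‖ ≤ ‖u‖ ^ e := by
  unfold padicEval
  refine IsUltrametricDist.norm_tsum_le_of_forall_le_of_nonneg (pow_nonneg (norm_nonneg u) e)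
    fun n => ?_
  rcases lt_or_ge n e with hn | hn
  · rw [he n hn, zero_mul, norm_zero]
    exact pow_nonneg (norm_nonneg u) e
  · rw [norm_mul, norm_pow]
    calc ‖coeff n h‖ * ‖u‖ ^ n ≤ 1 * ‖u‖ ^ e :=
          mul_le_mul (isPadicInt_iff_coeff.mp hh n)
            (pow_le_pow_of_le_one (norm_nonneg u) hu.le hn) (pow_nonneg (norm_nonneg u) n)
            zero_le_one
      _ = ‖u‖ ^ e := one_mul _

/-- Under the same vanishing, the degree-`e` term approximates to the next order:
`‖h(u) − h_e u^e‖ ≤ ‖u‖^(e+1)` for `‖u‖ < 1`. [folklore] -/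
private theorem deepArcGlue_norm_padicEval_sub_le_pow {h : ℚ_[p]⟦X⟧} (hh : IsPadicInt h) {e : ℕ}
    (he : ∀ n, n < e → coeff n h = 0) {u : ℚ_[p]} (hu : ‖u‖ < 1) :
    ‖padicEval h u - coeff e h * u ^ e‖ ≤ ‖u‖ ^ (e + 1) := by
  have hc : ‖coeff e h‖ ≤ 1 := isPadicInt_iff_coeff.mp hh e
  have hC : IsPadicInt (C (coeff e h) : ℚ_[p]⟦X⟧) := IsPadicInt.C hc
  have hXe : IsPadicInt (X ^ e : ℚ_[p]⟦X⟧) := IsPadicInt.powerSeries_X.pow e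
  have hCX : IsPadicInt (C (coeff e h) * X ^ e : ℚ_[p]⟦X⟧) := hC.mul hXe
  have heval : padicEval (C (coeff e h) * X ^ e : ℚ_[p]⟦X⟧) u = coeff e h * u ^ e := by
    rw [padicEval_mul hC hXe hu, padicEval_C, padicEval_pow IsPadicInt.powerSeries_X hu,
      padicEval_X]
  rw [← heval, ← padicEval_sub hh hCX hu]
  refine deepArcGlue_norm_padicEval_le_pow (hh.sub hCX) (fun n hn => ?_) hu
  rw [map_sub, coeff_C_mul_X_pow]
  rcases lt_or_eq_of_le (Nat.lt_succ_iff.mp hn) with hlt | rfl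
  · rw [he n hlt, if_neg hlt.ne, sub_zero]
  · rw [if_pos rfl, sub_self]

/-- **Deep points decide the order at `0`.** If an integral `h ∈ ℚ_p⟦X⟧` satisfies
`‖h(u)‖ ≤ K ‖u‖^s` at non-zero points `u` of arbitrarily small norm, then `h_n = 0` for all
`n < s`: at the least `n < s` with `h_n ≠ 0` and a deep `u` with `‖u‖ < ‖h_n‖`, `K‖u‖ < ‖h_n‖`
the leading term dominates, `‖h_n‖ ‖u‖^n = ‖h(u)‖ ≤ K ‖u‖^(n+1)`, a contradiction. [folklore] -/
private theorem deepArcGlue_coeff_eq_zero_of_deep {h : ℚ_[p]⟦X⟧} (hh : IsPadicInt h) {s : ℕ}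
    {K : ℝ} (hK : 0 ≤ K)
    (hdeep : ∀ ε : ℝ, 0 < ε → ∃ u : ℚ_[p], u ≠ 0 ∧ ‖u‖ < ε ∧ ‖padicEval h u‖ ≤ K * ‖u‖ ^ s) :
    ∀ n, n < s → coeff n h = 0 := by
  intro n
  induction n using Nat.strong_induction_on with
  | _ n ih =>
    intro hns
    by_contra hc
    have hc0 : 0 < ‖coeff n h‖ := norm_pos_iff.mpr hc
    have hc1 : ‖coeff n h‖ ≤ 1 := isPadicInt_iff_coeff.mp hh n
    have hlow : ∀ k, k < n → coeff k h = 0 := fun k hk => ih k hk (hk.trans hns)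
    have hK1 : (0 : ℝ) < K + 1 := by linarith
    obtain ⟨u, hu0, huε, hhu⟩ := hdeep (‖coeff n h‖ / (K + 1)) (div_pos hc0 hK1)
    have huc : ‖u‖ < ‖coeff n h‖ :=
      huε.trans_le (div_le_self (norm_nonneg _) (by linarith))
    have hu1 : ‖u‖ < 1 := huc.trans_le hc1
    have hun : 0 < ‖u‖ ^ n := pow_pos (norm_pos_iff.mpr hu0) n
    -- the leading term strictly dominates the tail
    have htail : ‖padicEval h u - coeff n h * u ^ n‖ < ‖coeff n h * u ^ n‖ := by
      calc ‖padicEval h u - coeff n h * u ^ n‖ ≤ ‖u‖ ^ (n + 1) :=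
            deepArcGlue_norm_padicEval_sub_le_pow hh hlow hu1
        _ = ‖u‖ * ‖u‖ ^ n := pow_succ' _ _
        _ < ‖coeff n h‖ * ‖u‖ ^ n := mul_lt_mul_of_pos_right huc hun
        _ = ‖coeff n h * u ^ n‖ := by rw [norm_mul, norm_pow]
    have hlead : ‖coeff n h * u ^ n‖ ≤ ‖padicEval h u‖ := by
      have h1 : ‖coeff n h * u ^ n‖ ≤
          max ‖coeff n h * u ^ n - padicEval h u‖ ‖padicEval h u‖ := by
        calc ‖coeff n h * u ^ n‖ = ‖(coeff n h * u ^ n - padicEval h u) + padicEval h u‖ := by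
              rw [sub_add_cancel]
          _ ≤ _ := IsUltrametricDist.norm_add_le_max _ _
      rw [norm_sub_rev] at h1
      rcases le_max_iff.mp h1 with h2 | h2
      · exact absurd h2 (not_le.mpr htail)
      · exact h2
    -- compare with the cap at the deep point
    have hcap : ‖padicEval h u‖ ≤ K * ‖u‖ * ‖u‖ ^ n := by
      calc ‖padicEval h u‖ ≤ K * ‖u‖ ^ s := hhu
        _ ≤ K * ‖u‖ ^ (n + 1) :=
            mul_le_mul_of_nonneg_left (pow_le_pow_of_le_one (norm_nonneg u) hu1.le hns) hK
        _ = K * ‖u‖ * ‖u‖ ^ n := by ring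
    have hle : ‖coeff n h‖ ≤ K * ‖u‖ := by
      have h3 : ‖coeff n h‖ * ‖u‖ ^ n ≤ K * ‖u‖ * ‖u‖ ^ n := by
        have h4 : ‖coeff n h‖ * ‖u‖ ^ n = ‖coeff n h * u ^ n‖ := by rw [norm_mul, norm_pow]
        rw [h4]
        exact hlead.trans hcap
      exact le_of_mul_le_mul_right h3 hun
    have hlt : K * ‖u‖ < ‖coeff n h‖ := by
      calc K * ‖u‖ ≤ K * (‖coeff n h‖ / (K + 1)) := mul_le_mul_of_nonneg_left huε.le hK
        _ = K / (K + 1) * ‖coeff n h‖ := by ring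
        _ < 1 * ‖coeff n h‖ :=
            mul_lt_mul_of_pos_right (by rw [div_lt_one hK1]; linarith) hc0
        _ = ‖coeff n h‖ := one_mul _
    linarith

/-- Consequently `‖h(u)‖ ≤ ‖u‖^s` on the whole open unit disc. [folklore] -/
private theorem deepArcGlue_norm_padicEval_le_of_deep {h : ℚ_[p]⟦X⟧} (hh : IsPadicInt h) {s : ℕ}
    {K : ℝ} (hK : 0 ≤ K)
    (hdeep : ∀ ε : ℝ, 0 < ε → ∃ u : ℚ_[p], u ≠ 0 ∧ ‖u‖ < ε ∧ ‖padicEval h u‖ ≤ K * ‖u‖ ^ s)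
    {u : ℚ_[p]} (hu : ‖u‖ < 1) : ‖padicEval h u‖ ≤ ‖u‖ ^ s :=
  deepArcGlue_norm_padicEval_le_pow hh (deepArcGlue_coeff_eq_zero_of_deep hh hK hdeep) hu

/-! ## Two variables to one: the arc series and its restriction to the axis `X₁ = 0` -/

/-- Restriction to the axis `v = 0`: `H(u, 0) = h(u)` with `h = Σ_n H_(n,0) Xⁿ` (the terms of the
defining `tsum` with `d 1 ≠ 0` vanish, the others are re-indexed by `n ↦ single 0 n`). [folklore] -/
private theorem deepArcGlue_padicEval₂_zero_right (H : MvPowerSeries (Fin 2) ℚ_[p]) (u : ℚ_[p]) :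
    padicEval₂ H u 0 =
      padicEval (PowerSeries.mk fun n => MvPowerSeries.coeff (Finsupp.single 0 n) H) u := by
  have hinj : Function.Injective fun n : ℕ => Finsupp.single (0 : Fin 2) n :=
    Finsupp.single_injective 0
  have hsupp : Function.support (fun d : Fin 2 →₀ ℕ =>
      MvPowerSeries.coeff d H * (u ^ d 0 * (0 : ℚ_[p]) ^ d 1)) ⊆
        Set.range fun n : ℕ => Finsupp.single (0 : Fin 2) n := by
    intro d hd
    rw [Function.mem_support] at hd
    have h1 : d 1 = 0 := by
      by_contra h1
      exact hd (by rw [zero_pow h1, mul_zero, mul_zero])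
    refine ⟨d 0, ?_⟩
    ext i
    fin_cases i
    · simp
    · simp [h1, Finsupp.single_eq_of_ne (show (1 : Fin 2) ≠ 0 by decide)]
  have key := hinj.tsum_eq hsupp
  unfold padicEval₂ padicEval
  refine key.symm.trans (tsum_congr fun n => ?_)
  simp [Finsupp.single_eq_of_ne (show (1 : Fin 2) ≠ 0 by decide), PowerSeries.coeff_mk]

/-- The substituted coordinates `(1 + X₀)^n − 1` are integral. [folklore] -/
private theorem deepArcGlue_isPadicInt_coord (n : ℕ) :
    IsPadicInt ((1 + MvPowerSeries.X 0) ^ n - 1 : MvPowerSeries (Fin 2) ℚ_[p]) :=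
  ((IsPadicInt.one.add (IsPadicInt.X 0)).pow n).sub IsPadicInt.one

/-- The substituted coordinates `(1 + X₀)^n − 1` have no constant term. [folklore] -/
private theorem deepArcGlue_constantCoeff_coord (n : ℕ) :
    MvPowerSeries.constantCoeff ((1 + MvPowerSeries.X 0) ^ n - 1 : MvPowerSeries (Fin 2) ℚ_[p]) = 0 := by
  simp

/-- The substituted coordinates evaluate as `(1 + u)^n − 1` on the open bidisc. [folklore] -/
private theorem deepArcGlue_padicEval₂_coord (n : ℕ) {u v : ℚ_[p]} (hu : ‖u‖ < 1) (hv : ‖v‖ < 1) :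
    padicEval₂ ((1 + MvPowerSeries.X 0) ^ n - 1 : MvPowerSeries (Fin 2) ℚ_[p]) u v =
      (1 + u) ^ n - 1 := by
  have hX : IsPadicInt (1 + MvPowerSeries.X 0 : MvPowerSeries (Fin 2) ℚ_[p]) :=
    IsPadicInt.one.add (IsPadicInt.X 0)
  have hone : padicEval₂ (1 : MvPowerSeries (Fin 2) ℚ_[p]) u v = 1 := by
    rw [show (1 : MvPowerSeries (Fin 2) ℚ_[p]) = MvPowerSeries.C (1 : ℚ_[p]) from
      (map_one (MvPowerSeries.C : ℚ_[p] →+* MvPowerSeries (Fin 2) ℚ_[p])).symm, padicEval₂_C]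
  rw [padicEval₂_sub (hX.pow n) IsPadicInt.one hu hv, padicEval₂_pow hX hu hv,
    padicEval₂_add IsPadicInt.one (IsPadicInt.X 0) hu hv, hone, padicEval₂_X]
  simp

/-- **The arc values are values of one integral one-variable series.** With
`H = F((1 + X₀)^b − 1, (1 + X₀)^a − 1)` and `h = Σ_n H_(n,0) Xⁿ`:
`F((1+p)^(bn) − 1, (1+p)^(an) − 1) = h((1+p)^n − 1)` whenever `‖(1+p)^n − 1‖ < 1`. [folklore] -/
private theorem deepArcGlue_arc_eq {F : MvPowerSeries (Fin 2) ℚ_[p]} (hF : IsPadicInt F) (a b n : ℕ)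
    (hT : ‖(1 + (p : ℚ_[p])) ^ n - 1‖ < 1) :
    padicEval₂ F ((1 + (p : ℚ_[p])) ^ (b * n) - 1) ((1 + (p : ℚ_[p])) ^ (a * n) - 1) =
      padicEval (PowerSeries.mk fun k => MvPowerSeries.coeff (Finsupp.single 0 k)
        (MvPowerSeries.subst
          ![((1 + MvPowerSeries.X 0) ^ b - 1 : MvPowerSeries (Fin 2) ℚ_[p]),
            ((1 + MvPowerSeries.X 0) ^ a - 1 : MvPowerSeries (Fin 2) ℚ_[p])] F))
        ((1 + (p : ℚ_[p])) ^ n - 1) := by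
  have h0 : ‖(0 : ℚ_[p])‖ < 1 := by rw [norm_zero]; exact one_pos
  rw [← deepArcGlue_padicEval₂_zero_right,
    padicEval₂_substPair hF (deepArcGlue_isPadicInt_coord b) (deepArcGlue_isPadicInt_coord a)
      (deepArcGlue_constantCoeff_coord b) (deepArcGlue_constantCoeff_coord a) hT h0,
    deepArcGlue_padicEval₂_coord b hT h0, deepArcGlue_padicEval₂_coord a hT h0, add_sub_cancel,
    ← pow_mul, ← pow_mul, mul_comm n b, mul_comm n a]

/-- The one-variable arc series `h` is integral. [folklore] -/
private theorem deepArcGlue_isPadicInt_arc {F : MvPowerSeries (Fin 2) ℚ_[p]} (hF : IsPadicInt F)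
    (a b : ℕ) :
    IsPadicInt (PowerSeries.mk fun k => MvPowerSeries.coeff (Finsupp.single 0 k)
        (MvPowerSeries.subst
          ![((1 + MvPowerSeries.X 0) ^ b - 1 : MvPowerSeries (Fin 2) ℚ_[p]),
            ((1 + MvPowerSeries.X 0) ^ a - 1 : MvPowerSeries (Fin 2) ℚ_[p])] F) : ℚ_[p]⟦X⟧) := by
  have hsub : IsPadicInt (MvPowerSeries.subst
      ![((1 + MvPowerSeries.X 0) ^ b - 1 : MvPowerSeries (Fin 2) ℚ_[p]),
        ((1 + MvPowerSeries.X 0) ^ a - 1 : MvPowerSeries (Fin 2) ℚ_[p])] F) := by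
    refine hF.subst (fun i => ?_) (MvPowerSeries.hasSubst_of_constantCoeff_zero fun i => ?_)
    · fin_cases i
      · exact deepArcGlue_isPadicInt_coord b
      · exact deepArcGlue_isPadicInt_coord a
    · fin_cases i
      · exact deepArcGlue_constantCoeff_coord b
      · exact deepArcGlue_constantCoeff_coord a
  exact isPadicInt_iff_coeff.mpr fun n => by rw [PowerSeries.coeff_mk]; exact hsub _

/-! ## Elementary `p`-adic and real arithmetic -/

/-- `‖(1+p)^n − 1‖ < 1`: the arc parameters lie in the open unit disc. [folklore] -/
private theorem deepArcGlue_norm_T_lt_one (hp2 : p ≠ 2) (n : ℕ) :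
    ‖(1 + (p : ℚ_[p])) ^ n - 1‖ < 1 := by
  calc ‖(1 + (p : ℚ_[p])) ^ n - 1‖ ≤ ‖(p : ℚ_[p])‖ * ‖(n : ℚ_[p])‖ :=
        stub_normOneAddPowSubOne p hp2 n
    _ ≤ ‖(p : ℚ_[p])‖ * 1 := by
        refine mul_le_mul_of_nonneg_left ?_ (norm_nonneg _)
        simpa using Padic.norm_int_le_one (p := p) (n : ℤ)
    _ < 1 := by rw [mul_one]; exact Padic.norm_p_lt_one

/-- `‖(1+p)^n − 1‖ ≤ ‖n‖_p`. [folklore] -/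
private theorem deepArcGlue_norm_T_le (hp2 : p ≠ 2) (n : ℕ) :
    ‖(1 + (p : ℚ_[p])) ^ n - 1‖ ≤ ‖(n : ℚ_[p])‖ := by
  calc ‖(1 + (p : ℚ_[p])) ^ n - 1‖ ≤ ‖(p : ℚ_[p])‖ * ‖(n : ℚ_[p])‖ :=
        stub_normOneAddPowSubOne p hp2 n
    _ ≤ 1 * ‖(n : ℚ_[p])‖ :=
        mul_le_mul_of_nonneg_right Padic.norm_p_lt_one.le (norm_nonneg _)
    _ = ‖(n : ℚ_[p])‖ := one_mul _

/-- `‖(1+p)^n − 1‖ = p^(−v_p(n)−1)` for `n > 0` (`stub_normCycPow`, recast). [folklore] -/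
private theorem deepArcGlue_norm_T_eq (hp2 : p ≠ 2) {n : ℕ} (hn : 0 < n) :
    ‖(1 + (p : ℚ_[p])) ^ n - 1‖ = (p : ℝ) ^ (-(padicValNat p n : ℤ) - 1) := by
  have h := stub_normCycPow p hp2 n hn
  rwa [Nat.cast_add, Nat.cast_one] at h

/-- Real arithmetic: `N · p^(s (v+1)) ≤ p^C` gives `N ≤ p^C · (p^(−v−1))^s`. [folklore] -/
private theorem deepArcGlue_cap_rearrange {N : ℝ} {s v C : ℕ}
    (h : N * (p : ℝ) ^ (s * (v + 1)) ≤ (p : ℝ) ^ C) :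
    N ≤ (p : ℝ) ^ C * ((p : ℝ) ^ (-(v : ℤ) - 1)) ^ s := by
  have hp0 : (0 : ℝ) < p := by exact_mod_cast (Fact.out : p.Prime).pos
  have hpow : ((p : ℝ) ^ (-(v : ℤ) - 1)) ^ s = ((p : ℝ) ^ (s * (v + 1)))⁻¹ := by
    rw [← zpow_natCast ((p : ℝ) ^ (-(v : ℤ) - 1)) s, ← zpow_mul,
      ← zpow_natCast (p : ℝ) (s * (v + 1)), ← zpow_neg]
    congr 1
    push_cast
    ring
  rw [hpow, ← div_eq_mul_inv, le_div_iff₀ (by positivity)]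
  exact h

/-! ## The stub -/

/-- **G · `stub_deepArcGlue` — a deep pointwise cap determines the arc order.** For an odd prime
`p`, an integral `F ∈ ℚ_p⟦X₀, X₁⟧`, exponents `a, b`, a rate `s` and a constant `C`: if for every
`m` there is a parameter `t > 0` of depth `v_p(t) ≥ m` with
`‖F((1+p)^(bt) − 1, (1+p)^(at) − 1)‖ · p^(s (v_p(t)+1)) ≤ p^C`, then
`‖F((1+p)^(bt) − 1, (1+p)^(at) − 1)‖ ≤ ‖t‖_p^s` for every `t > 0` (the order of vanishing of
`F ∘ arc` at `T = 0` is decided by any sequence of parameters tending to `0`). [folklore] -/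
theorem stub_deepArcGlue :
    ∀ (p : ℕ) [Fact p.Prime], p ≠ 2 → ∀ (F : MvPowerSeries (Fin 2) ℚ_[p]),
      Literature.NumberTheory.EllipticCurves.IsPadicInt F → ∀ (a b s C : ℕ),
      (∀ m : ℕ, ∃ t : ℕ, 0 < t ∧ m ≤ padicValNat p t ∧
        ‖Literature.NumberTheory.EllipticCurves.padicEval₂ F ((1 + (p : ℚ_[p])) ^ (b * t) - 1)
            ((1 + (p : ℚ_[p])) ^ (a * t) - 1)‖ * (p : ℝ) ^ (s * (padicValNat p t + 1)) ≤ (p : ℝ) ^ C) →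
      ∀ t : ℕ, 0 < t →
        ‖Literature.NumberTheory.EllipticCurves.padicEval₂ F ((1 + (p : ℚ_[p])) ^ (b * t) - 1)
            ((1 + (p : ℚ_[p])) ^ (a * t) - 1)‖ ≤ ‖(t : ℚ_[p])‖ ^ s := by
  intro p _ hp2 F hF a b s C hdeep t _
  -- the one-variable arc series `h` and the identification of the arc values
  obtain ⟨h, hh_def⟩ : ∃ h : ℚ_[p]⟦X⟧, h = PowerSeries.mk fun k =>
      MvPowerSeries.coeff (Finsupp.single 0 k) (MvPowerSeries.subst
        ![((1 + MvPowerSeries.X 0) ^ b - 1 : MvPowerSeries (Fin 2) ℚ_[p]),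
          ((1 + MvPowerSeries.X 0) ^ a - 1 : MvPowerSeries (Fin 2) ℚ_[p])] F) := ⟨_, rfl⟩
  have hhint : IsPadicInt h := by rw [hh_def]; exact deepArcGlue_isPadicInt_arc hF a b
  have harc : ∀ n : ℕ, padicEval₂ F ((1 + (p : ℚ_[p])) ^ (b * n) - 1)
      ((1 + (p : ℚ_[p])) ^ (a * n) - 1) = padicEval h ((1 + (p : ℚ_[p])) ^ n - 1) := fun n => by
    rw [hh_def]; exact deepArcGlue_arc_eq hF a b n (deepArcGlue_norm_T_lt_one hp2 n)
  -- the deep hypothesis, transported to `h`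
  have hp1 : (1 : ℝ) < p := by exact_mod_cast (Fact.out : p.Prime).one_lt
  have hdeep' : ∀ ε : ℝ, 0 < ε → ∃ u : ℚ_[p], u ≠ 0 ∧ ‖u‖ < ε ∧
      ‖padicEval h u‖ ≤ (p : ℝ) ^ C * ‖u‖ ^ s := by
    intro ε hε
    obtain ⟨m, hm⟩ := exists_pow_lt_of_lt_one hε (inv_lt_one_of_one_lt₀ hp1)
    obtain ⟨tm, htm, hvm, hcap⟩ := hdeep m
    refine ⟨(1 + (p : ℚ_[p])) ^ tm - 1, ?_, ?_, ?_⟩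
    · rw [← norm_pos_iff, deepArcGlue_norm_T_eq hp2 htm]
      positivity
    · rw [deepArcGlue_norm_T_eq hp2 htm]
      calc (p : ℝ) ^ (-(padicValNat p tm : ℤ) - 1) ≤ (p : ℝ) ^ (-(m : ℤ)) :=
            zpow_le_zpow_right₀ hp1.le (by omega)
        _ = ((p : ℝ)⁻¹) ^ m := by rw [zpow_neg, zpow_natCast, inv_pow]
        _ < ε := hm
    · rw [← harc tm, deepArcGlue_norm_T_eq hp2 htm]
      exact deepArcGlue_cap_rearrange hcap
  -- conclude on the whole disc, in particular at `T_t`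
  rw [harc t]
  calc ‖padicEval h ((1 + (p : ℚ_[p])) ^ t - 1)‖ ≤ ‖(1 + (p : ℚ_[p])) ^ t - 1‖ ^ s :=
        deepArcGlue_norm_padicEval_le_of_deep hhint (by positivity) hdeep'
          (deepArcGlue_norm_T_lt_one hp2 t)
    _ ≤ ‖(t : ℚ_[p])‖ ^ s :=
        pow_le_pow_left₀ (norm_nonneg _) (deepArcGlue_norm_T_le hp2 t) s

end Summit.BirchSwinnertonDyer.BirchSwinnertonDyer.Theorems

end
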